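/-
Copyright (c) 2026 the pub-hodgecm-mathlib formalisation cell (harness21).  Prover seat hodgecm-mathlib-LH4-p11 (g5), req620 Track A «(D-RAM) FOUR-FRAME» squad
(unit U2H_HSide, the (ρ2b′-X) road :418; payer by lineage LH4-p14 (g4) 2026-09-04T06:33Z «bottom (A) → LH4-p11»; the anisotropy letter the v3 chain leaves to the bottom).
-/
import Literature.NumberTheory.Automorphic.UnitaryLatticeTreeTypeTwoTransitive   -- ★ `det_antidiagonal_three`; brings ★ `pairing`, `pairing_apply`, `formCongr`, `StdForm`
import Literature.NumberTheory.Automorphic.UnitaryGroupFrameSubform        -- ★ `det_formCongr`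
import HarnessLib

/-!
# Crux `H413`, line LH4 «(D-RAM) FOUR-FRAME» — the (ρ2b′-X) road, bottom sockets: THE ANISOTROPIC LITERAL'S PLANE IS ANISOTROPIC, FROM THE FRAME EQUATION BY DETERMINANTS

Cell `hodgecm-mathlib` (D-0151), FLOOR 0, crux item H413 = `stmt-HodgeConjecture-24833`; squad F0∕P3c∕LH4; sockets served: the bottoms (A)∕(B)∕(C) of the (ρ2b′-X) payer chain
(`SOCKET-hOC*.v1`, LH4-p14 (g4) TypeSplit) — which carry the frame equation `formCongr σ_w P₁ (Φ₃)_w = block(diagonal dg, η)` and `η ∉ N(L_wˣ)` but, since the v3 re-cut,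
NO anisotropy letter for the plane `(diagonal dg)`, while ★ `toricCensusSum_unr_weld_of_frame` wants `haniso : ¬ ∃ x ≠ 0, h′·Θx·x + ρ(h′·Θx·x) = 0` for the anisotropic scalar.
THEOREMS ONLY (no `def`, no instance, no notation, no `sorry`, default heartbeats); lane `--supports stmt-HodgeConjecture-24833 --as helper` (count-neutral).  ABSTRACT letters
(any field `K` with a ring endomorphism `σ`; any line model `(M, jE, ρ, Θ, φ, h′)`).

* §1 `det_block_diagonal` (`= dg 0 · η · dg 1`); `det Φ₃ = −1` is ★ `det_antidiagonal_three`.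
* §2 `not_exists_pairing_diagonal_self_eq_zero_of_formCongr` — if `ᵗσ(P)·((StdForm.antidiagonal 3).over K)·P = block(diagonal dg, η)` with `dg i`, `η` `σ`-fixed, `dg i ≠ 0` and
  `η` NOT a norm `t·σt`, then `pairing σ (diagonal dg) x x = 0 ⇒ x = 0`: determinants give `dg₀·dg₁·η = −det P·σ(det P)`, and an isotropic vector would make `−dg₀dg₁` a norm,
  hence `η` a norm.
* §3 `not_exists_herm_self_eq_zero_of_lineModel` — the same read on a line model: `jE⟨x, y⟩ = h′Θ(φx)φy + ρ(h′Θ(φx)φy)` with `φ` onto and `jE` injective ⇒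
  `¬ ∃ z ≠ 0, h′·Θz·z + ρ(h′·Θz·z) = 0` (the weld's `haniso`).
HONEST LABEL.  Count-neutral; nothing printed is asserted; (ρ2b′-X) stays OPEN; `HC_CM` is proved only modulo the 7 printed citations (2 remaining named inputs: hLiu418 =
`stmt-HodgeConjecture-24832`, h413 = `stmt-HodgeConjecture-24833`) until rung 0 closes.

## References
* [Jacobowitz1962] R. Jacobowitz, *Hermitian forms over local fields*, Amer. J. Math. 84 (1962), §3 (discriminants of hermitian forms), §4.
* [Rogawski1990] J. D. Rogawski, *Automorphic Representations of Unitary Groups in Three Variables*, Ann. of Math. Stud. 123 (1990), §3.6 pp. 28–29; §4.9 Lemma 4.9.3 p. 56.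
-/

set_option autoImplicit false

noncomputable section

open scoped Matrix MatrixGroups
open Literature.NumberTheory.Automorphic Literature.NumberTheory.Automorphic.UnitaryGroup
open Literature.NumberTheory.Automorphic.UnitaryLatticeTree

namespace Summit.HodgeConjecture.HodgeConjecture.Cruxes.H413.F0P3cDyRamTypeTwoAnisotropyOfFrame

/-! ## §1 The block determinant -/

section Det

variable {K : Type*} [Field K]

/-- `det block(diagonal dg, η) = dg 0 · η · dg 1`. [cite: Jacobowitz1962, §3] -/
theorem det_block_diagonal (dg : Fin 2 → K) (η : K) :
    (!![(Matrix.diagonal dg) 0 0, 0, (Matrix.diagonal dg) 0 1; 0, η, 0; (Matrix.diagonal dg) 1 0, 0, (Matrix.diagonal dg) 1 1] : Matrix (Fin 3) (Fin 3) K).det =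
      dg 0 * η * dg 1 := by
  rw [Matrix.det_fin_three]
  simp [Matrix.diagonal]

end Det

/-! ## §2 Anisotropy of the plane from the frame equation -/

section Aniso

variable {K : Type*} [Field K]

/-- **THE ANISOTROPIC LITERAL'S PLANE IS ANISOTROPIC.**  If `formCongr σ P Φ₃ = block(diagonal dg, η)` with `σ(dg i) = dg i`, `dg i ≠ 0`, `σ η = η` and `η` is NOT a norm
`t·σ(t)`, then the hermitian plane `diagonal dg` has no isotropic vector: `pairing σ (diagonal dg) x x = 0 ⇒ x = 0`.  (Determinants of the frame equation:
`dg₀·η·dg₁ = σ(det P)·(−1)·det P`; an isotropic `x` has both coordinates non-zero and gives `−dg₀dg₁ = N(dg₁x₁∕x₀)`, whence `η = N(det P·x₀∕(dg₁x₁))`.)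
[cite: Jacobowitz1962, §3, §4] [cite: Rogawski1990, §3.6 pp. 28–29] -/
theorem not_exists_pairing_diagonal_self_eq_zero_of_formCongr (σ : K →+* K) (P : GL (Fin 3) K) (dg : Fin 2 → K) (η : K)
    (hfc : formCongr σ P ((StdForm.antidiagonal 3).over K) =
      (!![(Matrix.diagonal dg) 0 0, 0, (Matrix.diagonal dg) 0 1; 0, η, 0; (Matrix.diagonal dg) 1 0, 0, (Matrix.diagonal dg) 1 1] : Matrix (Fin 3) (Fin 3) K))
    (hdgσ : ∀ i, σ (dg i) = dg i) (hdg0 : ∀ i, dg i ≠ 0) (hηN : ¬ ∃ t : K, t * σ t = η) :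
    ¬ ∃ x : Fin 2 → K, x ≠ 0 ∧ pairing σ (Matrix.diagonal dg) x x = 0 := by
  rintro ⟨x, hx0, hx⟩
  -- the determinant identity `dg₀ η dg₁ = −σ(det P)·det P`
  have hdet : dg 0 * η * dg 1 = -(σ (P : Matrix (Fin 3) (Fin 3) K).det * (P : Matrix (Fin 3) (Fin 3) K).det) := by
    have h := congrArg Matrix.det hfc
    rw [det_formCongr, det_antidiagonal_three, det_block_diagonal] at h
    rw [← h]; ring
  have hP0 : (P : Matrix (Fin 3) (Fin 3) K).det ≠ 0 := (Matrix.isUnits_det_units P).ne_zero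
  -- the isotropy equation `σx₀ dg₀ x₀ + σx₁ dg₁ x₁ = 0`
  have hiso : σ (x 0) * dg 0 * x 0 + σ (x 1) * dg 1 * x 1 = 0 := by
    rw [pairing_apply] at hx
    simpa [Fin.sum_univ_two, Matrix.diagonal] using hx
  -- both coordinates are non-zero
  have hx0' : x 0 ≠ 0 := by
    intro h0
    have h1 : σ (x 1) * dg 1 * x 1 = 0 := by rw [h0, map_zero, zero_mul, zero_mul, zero_add] at hiso; exact hiso
    rcases mul_eq_zero.1 h1 with h1 | h1
    · rcases mul_eq_zero.1 h1 with h1 | h1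
      · have : x 1 = 0 := by rwa [map_eq_zero] at h1
        exact hx0 (funext fun i => by fin_cases i <;> assumption)
      · exact hdg0 1 h1
    · exact hx0 (funext fun i => by fin_cases i <;> assumption)
  have hx1' : x 1 ≠ 0 := by
    intro h1
    have h0 : σ (x 0) * dg 0 * x 0 = 0 := by rw [h1, map_zero, zero_mul, zero_mul, add_zero] at hiso; exact hiso
    rcases mul_eq_zero.1 h0 with h0 | h0
    · rcases mul_eq_zero.1 h0 with h0 | h0
      · exact hx0' (by rwa [map_eq_zero] at h0)
      · exact hdg0 0 h0
    · exact hx0' h0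
  -- `η` is a norm: `η = N(det P · x₀ ∕ (dg₁ · x₁))`
  refine hηN ⟨(P : Matrix (Fin 3) (Fin 3) K).det * x 0 / (dg 1 * x 1), ?_⟩
  have hσx1 : σ (x 1) ≠ 0 := (map_ne_zero σ).2 hx1'
  have hden : dg 1 * x 1 * (dg 1 * σ (x 1)) ≠ 0 := mul_ne_zero (mul_ne_zero (hdg0 1) hx1') (mul_ne_zero (hdg0 1) hσx1)
  rw [map_div₀, map_mul, map_mul, hdgσ, div_mul_div_comm, div_eq_iff hden]
  -- goal is polynomial: use the two identities
  linear_combination (x 0 * σ (x 0)) * hdet + (-(η * dg 1)) * hiso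

end Aniso

/-! ## §3 The same, read on a line model -/

section LineModel

variable {K M : Type*} [Field K] [Field M] {ρ Θ : M →+* M}

/-- **`haniso` FOR THE WELD**: if the plane `(K², H₂)` has no isotropic vector and `(M, jE, ρ, Θ; φ, h′)` is a line model of it (`jE⟨x, y⟩ = h′Θ(φx)φy + ρ(h′Θ(φx)φy)`, `φ` additive
and onto, `jE` a ring map), then `¬ ∃ z ≠ 0, h′·Θz·z + ρ(h′·Θz·z) = 0`. [cite: Jacobowitz1962, §4] [cite: Rogawski1990, §4.9 Lemma 4.9.3 p. 56] -/
theorem not_exists_herm_self_eq_zero_of_lineModel (σ : K →+* K) (H₂ : Matrix (Fin 2) (Fin 2) K) (jE : K →+* M) (φ : (Fin 2 → K) →+ M)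
    (hφo : Function.Surjective φ) {h' : M} (hform : ∀ x y, jE (pairing σ H₂ x y) = h' * Θ (φ x) * φ y + ρ (h' * Θ (φ x) * φ y))
    (haniso : ¬ ∃ x : Fin 2 → K, x ≠ 0 ∧ pairing σ H₂ x x = 0) :
    ¬ ∃ z : M, z ≠ 0 ∧ h' * Θ z * z + ρ (h' * Θ z * z) = 0 := by
  rintro ⟨z, hz0, hz⟩
  obtain ⟨x, rfl⟩ := hφo z
  refine haniso ⟨x, fun hx => hz0 (by rw [hx, map_zero]), ?_⟩
  have h := hform x x
  rw [hz] at h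
  exact (map_eq_zero jE).1 h

end LineModel

end Summit.HodgeConjecture.HodgeConjecture.Cruxes.H413.F0P3cDyRamTypeTwoAnisotropyOfFrame

end
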